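import Literature.AnabelianGeometry.SemiGraphs.TemperedSpecialFibreReductions
import Literature.AnabelianGeometry.SemiGraphs.Prop36HypothesesWitnessAffChart
import Literature.AnabelianGeometry.SemiGraphs.OncePuncturedTemperedGroupPadicWitness
import Literature.AnabelianGeometry.SemiGraphs.TemperedArithmeticGroupPadicWitness
import Literature.AnabelianGeometry.SemiGraphs.TemperedDecompositionCompact
import HarnessLib

/-!
# [SemiAnbd] Cor. 3.11, proof steps (S1)/(S2) as typed (FACT-LIST F-1724 / F-1725): the schemas
# `AdmissibleQuotientCompatible Ωα Ωβ`, `ResidueCharOfTemperedIso pα pβ Ωα Ωβ` have FALSE universal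
# closure over the origin parameter — kernel counter-instances at an all-certifying origin

Mochizuki, *Semi-graphs of anabelioids*, Publ. RIMS **42** (2006), §3, Corollary 3.11 and its proof,
manuscript pp. 45–49 [cite: MochizukiSemiAnbd2006, Cor 3.11 pp.45-49]: "any isomorphism `γ : Δ[α] ⥲ Δ[β]`
… the quotients … are compatible with `γ`" (p. 46), "we obtain that `p_α = p_β`" (p. 48).

PROOF-ONLY companion of `TemperedSpecialFibreReductions.lean` (abc-iut-L3-d?; no statement of that file is
touched; no `def`, no `instance`), abc-iut cell seat abc-iut-w6-d077 (block C, F-TRANCHE 177; FACT-LIST rows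
**F-1724** `AdmissibleQuotientCompatible`, **F-1725** `ResidueCharOfTemperedIso`; class `preparatory`,
kernel_closedness `parametrised` — the parameters are the ORIGIN HYPOTHESES `Ωα : SpecialFibreOrigin Kα`,
`Ωβ : SpecialFibreOrigin Kβ`).

The two named residual facts are typed OVER an origin predicate `SpecialFibreOrigin K` (a hypothesis
structure whose field `IsSpecialFibreOf D S` is meant to certify "`S` IS the special-fibre semi-graph of
anabelioids of the stable model of the curve whose tempered fundamental group is `D`"; it is asserted for
no instance in the tree).  Read as a statement about ALL origins — the universal closure
`∀ Kα Kβ Ωα Ωβ, …` — each is FALSE, because an origin may certify junk: at the ALL-CERTIFYING origin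
(`IsSpecialFibreOf := ⊤`) the tree's consistency witnesses for the interface `SpecialFibreData` supply
counter-instances.  Model (all pieces BY NAME from the tree): over the base `ℚ_p`, the tempered arithmetic
group `Π := B × G_{ℚ_p}` with augmentation `pr₂` (so `Δ ≅ B`), for `B` any slim profinite second-countable
group — tempered (`IsTempered.of_profinite`, [SemiAnbd] Rmk. 3.1.1), slim (`isSlimGroup_prod`, abc-iut-w5-d218,
with `galoisMLF_slim_holds`, abc-iut-L4: `G_{ℚ_p}` is slim), Galois-countable
(`secondCountableTopology_absoluteGaloisGroup_padic`), exactly as in `OncePuncturedTemperedGroupPadicWitness`;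
and the special-fibre datum `G^c :=` the one-vertex edgeless semi-graph of anabelioids with `Π_v = Aff(ℤ_q)`
(`affWitness q`, abc-iut-w5-d212, satisfying the hypotheses of Thm. 3.7), chart `π₁^temp(G^c) = Aff(ℤ_q)`
(`affChart q`, abc-iut-w5-d236), admissible quotient `Δ ≅ B ↠ Aff(ℤ_q)` any continuous surjection
(`exists_padicProductModel`).

* (S1) `not_admissibleQuotientCompatible_of_allCertifying` / `not_forall_admissibleQuotientCompatible`:
  with `B := Aff(ℤ_q) × Aff(ℤ_q)`, admissible quotient `pr₁` (NOT injective) and `γ :=` the swap of the two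
  factors of `Δ`, no `φ` satisfies `φ (pr₁ x) = pr₁ (γ x)` (take `x = (1, g)`, `g ≠ 1`).
* (S2) `not_residueCharOfTemperedIso_of_allCertifying` / `not_forall_residueCharOfTemperedIso`: bases
  `ℚ_2` and `ℚ_3`, `B := Aff(ℤ_2)` on both sides, so `Δ[α] ≅ Δ[β]` while `p_α = 2 ≠ 3 = p_β`.

So each row is admissible ONLY at named (genuine) origins — FACT-LIST class «universal-closure REFUTED /
schema; instance forms open»; the rows' one consumer is the PROVED reduction
`corollary_3_11_of_steps` (and `corollary_3_11_of_steps'`, `TemperedSpecialFibreReductionsDescended.lean`),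
which takes them as hypotheses at a given origin pair.  This is a remark about OUR typing (the origin is a
free parameter), not about the paper: nothing here refutes any statement of [SemiAnbd]; the (S3) row
`SpecialFibreIsoOfChartIso` (F-1727) is not refuted by this model (at the one-vertex datum its conclusion is
satisfiable).  Nothing here bears on the disputed [IUTchIII] Cor. 3.12 or takes a side.
-/

noncomputable section

namespace Literature.AnabelianGeometry.SemiGraphs

open ProfiniteSemiGraph Topology
open Literature.GroupTheory.SpecificGroups
open Literature.AlgebraicGeometry.Frobenioids (IsSlimGroup)

/-! ### The model: `Π = B × G_{ℚ_p}`, `Δ ≅ B ↠ Aff(ℤ_q) = π₁^temp(affWitness q)` -/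

/-- **A tempered arithmetic group over `ℚ_p` with prescribed geometric part and a special-fibre datum with
prescribed admissible quotient.**  For `B` a slim profinite second-countable group and a continuous
surjection `π : B ↠ Aff(ℤ_q)`: `Π := B × G_{ℚ_p}` with augmentation `pr₂` is a `TemperedArithmeticGroup ℚ_p`
(tempered: profinite; slim: `isSlimGroup_prod` + `galoisMLF_slim_holds`; Galois-countable) with `Δ ≅ B`,
and `(affWitness q, affChart q, π)` is a `SpecialFibreData` on it whose admissible quotient is `π` read on
`Δ ≅ B`.  Consistency witness only (DEGENERATE: split extension, one-vertex special fibre); no origin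
certificate is claimed. [cite: MochizukiSemiAnbd2006, Ex 3.10 pp.43-45] -/
theorem exists_padicProductModel (p q : ℕ) [Fact p.Prime] [Fact q.Prime]
    (B : Type) [Group B] [TopologicalSpace B] [IsTopologicalGroup B] [CompactSpace B] [T2Space B]
    [TotallyDisconnectedSpace B] [SecondCountableTopology B] (hB : IsSlimGroup B)
    (π : B →ₜ* PadicAffine q) (hπ : Function.Surjective π) :
    ∃ (D : TemperedArithmeticGroup ℚ_[p]) (e : B ≃ₜ* D.delta) (S : SpecialFibreData D)
      (ι : S.chart.G ≃ₜ* PadicAffine q), ∀ b : B, ι (S.admissible (e b)) = π b := by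
  classical
  haveI : IsGalois ℚ_[p] (AlgebraicClosure ℚ_[p]) := {}
  haveI : CompactSpace (Field.absoluteGaloisGroup ℚ_[p]) := by
    change CompactSpace (AlgebraicClosure ℚ_[p] ≃ₐ[ℚ_[p]] AlgebraicClosure ℚ_[p]); infer_instance
  haveI : T2Space (Field.absoluteGaloisGroup ℚ_[p]) := krullTopology_t2
  haveI : TotallyDisconnectedSpace (Field.absoluteGaloisGroup ℚ_[p]) := by
    change TotallyDisconnectedSpace (AlgebraicClosure ℚ_[p] ≃ₐ[ℚ_[p]] AlgebraicClosure ℚ_[p])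
    infer_instance
  haveI : SecondCountableTopology (Field.absoluteGaloisGroup ℚ_[p]) :=
    secondCountableTopology_absoluteGaloisGroup_padic p
  have hSlimG : IsSlimGroup (Field.absoluteGaloisGroup ℚ_[p]) :=
    Literature.AnabelianGeometry.AbsoluteAnabelian.galoisMLF_slim_holds p ℚ_[p]
  -- the augmentation `pr₂ : B × G → G` and its kernel `B × 1 ≅ B`
  let aug : (B × Field.absoluteGaloisGroup ℚ_[p]) →ₜ* Field.absoluteGaloisGroup ℚ_[p] :=
    ContinuousMonoidHom.snd _ _
  have haug_mem : ∀ x : B × Field.absoluteGaloisGroup ℚ_[p], x ∈ aug.toMonoidHom.ker ↔ x.2 = 1 :=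
    fun x => MonoidHom.mem_ker
  have hkerClosed : IsClosed (aug.toMonoidHom.ker : Set (B × Field.absoluteGaloisGroup ℚ_[p])) := by
    rw [MonoidHom.coe_ker]; exact isClosed_singleton.preimage (map_continuous aug)
  let eKer : B ≃ₜ* aug.toMonoidHom.ker :=
    { toFun := fun b => ⟨(b, 1), (haug_mem _).mpr rfl⟩
      invFun := fun x => x.1.1
      left_inv := fun _ => rfl
      right_inv := fun x => by
        obtain ⟨⟨b, g⟩, hx⟩ := x
        have hg : g = 1 := (haug_mem _).mp hx
        subst hg; rfl
      map_mul' := fun _ _ => rfl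
      continuous_toFun := (continuous_id.prodMk continuous_const).subtype_mk _
      continuous_invFun := continuous_fst.comp continuous_subtype_val }
  have hT : IsTempered (B × Field.absoluteGaloisGroup ℚ_[p]) := IsTempered.of_profinite
  let D : TemperedArithmeticGroup ℚ_[p] :=
    { Pi := B × Field.absoluteGaloisGroup ℚ_[p]
      isTempered := hT
      aug := aug
      aug_surjective := fun g => ⟨(1, g), rfl⟩
      isTempered_ker := hT.subgroup_of_isClosed _ hkerClosed
      isSlimGroup := isSlimGroup_prod hB hSlimG
      isSlimGroup_ker := isSlimGroup_of_continuousMulEquiv eKer hB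
      secondCountableTopology := inferInstance }
  -- the admissible quotient `Δ ≅ B ↠ Aff(ℤ_q)`
  let adm : D.delta →ₜ* PadicAffine q :=
    ⟨π.toMonoidHom.comp eKer.symm.toMulEquiv.toMonoidHom,
      by exact (map_continuous π).comp (map_continuous eKer.symm)⟩
  refine ⟨D, eKer,
    { Gc := affWitness q
      hyp := affWitness_thm37Hypotheses
      chart := affChart q
      admissible := adm
      admissible_surjective := hπ.comp eKer.symm.surjective },
    ContinuousMulEquiv.refl _, fun b => ?_⟩
  exact congrArg π (eKer.symm_apply_apply b)

/-! ### F-1724: (S1) `AdmissibleQuotientCompatible` -/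

/-- `Aff(ℤ_q)` is nontrivial: the translation `x ↦ x + 1` is not the identity. [folklore] -/
private theorem padicAffine_transl_one_ne_one (q : ℕ) [Fact q.Prime] :
    (⟨1, 1⟩ : PadicAffine q) ≠ 1 := fun h =>
  one_ne_zero (congrArg PadicAffine.a h)

/-- **F-1724 fails at every all-certifying origin** (base `ℚ_p`): `¬ AdmissibleQuotientCompatible Ωα Ωβ`
whenever `Ωα`, `Ωβ` certify every special-fibre datum — witnessed by `Δ ≅ Aff(ℤ_p) × Aff(ℤ_p)` with the
NON-injective admissible quotient `pr₁` on both sides and `γ :=` the swap of the factors: a descended `φ`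
would satisfy `φ (pr₁ (1, g)) = pr₁ (g, 1)`, i.e. `g = 1` for every `g`.
[cite: MochizukiSemiAnbd2006, Cor 3.11 p.46] -/
theorem not_admissibleQuotientCompatible_of_allCertifying (p : ℕ) [Fact p.Prime]
    (Ωα Ωβ : SpecialFibreOrigin ℚ_[p])
    (hα : ∀ D S, Ωα.IsSpecialFibreOf D S) (hβ : ∀ D S, Ωβ.IsSpecialFibreOf D S) :
    ¬ AdmissibleQuotientCompatible Ωα Ωβ := by
  intro h
  haveI : SecondCountableTopology (PadicAffine p) := secondCountableTopology_padicAffine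
  have hA : IsSlimGroup (PadicAffine p) := ⟨PadicAffine.centralizer_eq_bot_of_isOpen⟩
  obtain ⟨D, e, S, ι, hι⟩ := exists_padicProductModel p p (PadicAffine p × PadicAffine p)
    (isSlimGroup_prod hA hA) (ContinuousMonoidHom.fst _ _) Prod.fst_surjective
  -- the swap of the two factors of `Δ ≅ Aff × Aff`
  let σ : (PadicAffine p × PadicAffine p) ≃ₜ* (PadicAffine p × PadicAffine p) :=
    { MulEquiv.prodComm with
      continuous_toFun := continuous_swap
      continuous_invFun := continuous_swap }
  let γ : D.delta ≃ₜ* D.delta := e.symm.trans (σ.trans e)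
  have hγ : ∀ a b : PadicAffine p, γ (e (a, b)) = e (b, a) := fun a b => by
    show e (σ (e.symm (e (a, b)))) = e (b, a)
    rw [e.symm_apply_apply]
    rfl
  obtain ⟨φ, hφ⟩ := h D D S S (hα _ _) (hβ _ _) γ
  set g : PadicAffine p := ⟨1, 1⟩ with hg_def
  have hg : g ≠ 1 := padicAffine_transl_one_ne_one p
  have h1 := hφ (e (1, g))
  have h2 := hφ (e (1, 1))
  rw [hγ] at h1 h2
  -- both `(1, g)` and `(1, 1)` have the same admissible image `1`
  have hx : S.admissible (e (1, g)) = S.admissible (e (1, 1)) :=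
    ι.injective (by rw [hι, hι]; rfl)
  have h3 : S.admissible (e (g, 1)) = S.admissible (e (1, 1)) := by rw [← h1, ← h2, hx]
  have h4 := congrArg ι h3
  rw [hι, hι] at h4
  exact hg h4

/-- **F-1724 as typed is not a fact over ALL origins:** the universal closure
`∀ Kα Kβ (Ωα : SpecialFibreOrigin Kα) (Ωβ : SpecialFibreOrigin Kβ), AdmissibleQuotientCompatible Ωα Ωβ`
(universe level `0`) is FALSE (all-certifying origins over `ℚ_2`).  Admissible only at named genuine
origins; consumer: `corollary_3_11_of_steps`. [cite: MochizukiSemiAnbd2006, Cor 3.11 p.46] -/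
theorem not_forall_admissibleQuotientCompatible :
    ¬ ∀ {Kα : Type} [Field Kα] {Kβ : Type} [Field Kβ]
        (Ωα : SpecialFibreOrigin Kα) (Ωβ : SpecialFibreOrigin Kβ), AdmissibleQuotientCompatible Ωα Ωβ := by
  intro h
  let Ω : SpecialFibreOrigin ℚ_[2] :=
    { IsOfGeometricOrigin := fun _ => True
      IsTateOrigin := fun _ => True
      isOfGeometricOrigin_of_isTateOrigin := fun _ _ => trivial
      IsSpecialFibreOf := fun _ _ => True
      isOfGeometricOrigin_of_isSpecialFibreOf := fun _ _ _ => trivial }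
  exact not_admissibleQuotientCompatible_of_allCertifying 2 Ω Ω (fun _ _ => trivial)
    (fun _ _ => trivial) (h Ω Ω)

/-! ### F-1725: (S2) `ResidueCharOfTemperedIso` -/

/-- **F-1725 fails at every all-certifying pair of origins over `ℚ_2`, `ℚ_3`:**
`¬ ResidueCharOfTemperedIso 2 3 Ωα Ωβ` — on both sides `Δ ≅ Aff(ℤ_2)` (geometric part of
`Aff(ℤ_2) × G_{ℚ_2}`, resp. `Aff(ℤ_2) × G_{ℚ_3}`) carries the one-vertex special-fibre datum, so
`Δ[α] ≅ Δ[β]` while `2 ≠ 3`. [cite: MochizukiSemiAnbd2006, Cor 3.11 p.48] -/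
theorem not_residueCharOfTemperedIso_of_allCertifying
    (Ωα : SpecialFibreOrigin ℚ_[2]) (Ωβ : SpecialFibreOrigin ℚ_[3])
    (hα : ∀ D S, Ωα.IsSpecialFibreOf D S) (hβ : ∀ D S, Ωβ.IsSpecialFibreOf D S) :
    ¬ ResidueCharOfTemperedIso 2 3 Ωα Ωβ := by
  intro h
  haveI : SecondCountableTopology (PadicAffine 2) := secondCountableTopology_padicAffine
  have hA : IsSlimGroup (PadicAffine 2) := ⟨PadicAffine.centralizer_eq_bot_of_isOpen⟩
  obtain ⟨Dα, eα, Sα, -, -⟩ := exists_padicProductModel 2 2 (PadicAffine 2) hA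
    (ContinuousMonoidHom.id _) Function.surjective_id
  obtain ⟨Dβ, eβ, Sβ, -, -⟩ := exists_padicProductModel 3 2 (PadicAffine 2) hA
    (ContinuousMonoidHom.id _) Function.surjective_id
  have h23 : (2 : ℕ) = 3 := h Dα Dβ Sα Sβ (hα _ _) (hβ _ _) ⟨eα.symm.trans eβ⟩
  omega

/-- **F-1725 as typed is not a fact over ALL origins:** the universal closure
`∀ Kα Kβ pα pβ … (Ωα : SpecialFibreOrigin Kα) (Ωβ : SpecialFibreOrigin Kβ), ResidueCharOfTemperedIso pα pβ Ωα Ωβ`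
(universe level `0`) is FALSE (all-certifying origins over `ℚ_2`, `ℚ_3`).  Admissible only at named
genuine origins; consumer: `corollary_3_11_of_steps`. [cite: MochizukiSemiAnbd2006, Cor 3.11 p.48] -/
theorem not_forall_residueCharOfTemperedIso :
    ¬ ∀ {Kα : Type} [Field Kα] {Kβ : Type} [Field Kβ] (pα pβ : ℕ) [Fact pα.Prime] [Fact pβ.Prime]
        [Algebra ℚ_[pα] Kα] [FiniteDimensional ℚ_[pα] Kα] [Algebra ℚ_[pβ] Kβ]
        [FiniteDimensional ℚ_[pβ] Kβ] (Ωα : SpecialFibreOrigin Kα) (Ωβ : SpecialFibreOrigin Kβ),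
        ResidueCharOfTemperedIso pα pβ Ωα Ωβ := by
  intro h
  let Ωα : SpecialFibreOrigin ℚ_[2] :=
    { IsOfGeometricOrigin := fun _ => True
      IsTateOrigin := fun _ => True
      isOfGeometricOrigin_of_isTateOrigin := fun _ _ => trivial
      IsSpecialFibreOf := fun _ _ => True
      isOfGeometricOrigin_of_isSpecialFibreOf := fun _ _ _ => trivial }
  let Ωβ : SpecialFibreOrigin ℚ_[3] :=
    { IsOfGeometricOrigin := fun _ => True
      IsTateOrigin := fun _ => True
      isOfGeometricOrigin_of_isTateOrigin := fun _ _ => trivial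
      IsSpecialFibreOf := fun _ _ => True
      isOfGeometricOrigin_of_isSpecialFibreOf := fun _ _ _ => trivial }
  exact not_residueCharOfTemperedIso_of_allCertifying Ωα Ωβ (fun _ _ => trivial) (fun _ _ => trivial)
    (h 2 3 Ωα Ωβ)

/-! ### F-1727: (S3) `SpecialFibreIsoOfChartIso` HOLDS at the one-vertex datum (model witness, not a
refutation) -/

/-- **(S3) at the one-vertex special fibre.**  For special-fibre data whose semi-graph of anabelioids is
the one-vertex edgeless `affWitness q` with its explicit chart `π₁^temp = Aff(ℤ_q)` (`affChart q`), EVERY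
automorphism `φ` of the chart group is realised by an isomorphism of semi-graphs of anabelioids compatible
with it — namely the one-vertex morphism with vertex homomorphism `φ` itself: every verticial homomorphism
of the explicit chart is inner (`exists_conj_eq_of_isVerticialHom_affChart`, Prop. 3.2), so the
compatibility `φ (a x a⁻¹) = g · b φ(x) b⁻¹ · g⁻¹` is solved by `g := φ(a) b⁻¹`; uniqueness on the
underlying one-vertex semi-graph is trivial.  Consistency evidence for the typed step (S3) of the proof
of [SemiAnbd] Cor. 3.11 (p. 46 "extends uniquely to a natural, functorial isomorphism of semi-graphs of
anabelioids"); nothing of the paper is asserted. [cite: MochizukiSemiAnbd2006, Cor 3.11 pp.46-49] -/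
theorem specialFibreIsoOfChartIso_conclusion_affWitness (q : ℕ) [Fact q.Prime]
    {Kα : Type} [Field Kα] {Kβ : Type} [Field Kβ]
    {Dα : TemperedArithmeticGroup Kα} {Dβ : TemperedArithmeticGroup Kβ}
    (Sα : SpecialFibreData Dα) (Sβ : SpecialFibreData Dβ)
    (hα : Sα.Gc = affWitness q ∧ HEq Sα.chart (affChart q))
    (hβ : Sβ.Gc = affWitness q ∧ HEq Sβ.chart (affChart q)) (φ : Sα.chart.G ≃ₜ* Sβ.chart.G) :
    ∃ F : Hom Sα.Gc Sβ.Gc, F.IsIso ∧ Sα.ChartCompatible Sβ φ F ∧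
      ∀ F' : Hom Sα.Gc Sβ.Gc, F'.IsIso → Sα.ChartCompatible Sβ φ F' →
        F'.base.vertexMap = F.base.vertexMap ∧ F'.base.edgeMap = F.base.edgeMap := by
  obtain ⟨Gcα, hypα, cα, admα, hsα⟩ := Sα
  obtain ⟨Gcβ, hypβ, cβ, admβ, hsβ⟩ := Sβ
  obtain ⟨rfl, hcα⟩ := hα
  obtain ⟨rfl, hcβ⟩ := hβ
  obtain rfl := eq_of_heq hcα
  obtain rfl := eq_of_heq hcβ
  -- now both data are `(affWitness q, affChart q, –)` and `φ : Aff(ℤ_q) ≃ₜ* Aff(ℤ_q)`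
  change PadicAffine q ≃ₜ* PadicAffine q at φ
  let F : Hom (affWitness q) (affWitness q) :=
    { base :=
        { vertexMap := fun v => v
          edgeMap := fun e => nomatch e
          branchMap := fun b => nomatch b
          edgeOf_branchMap := fun b => nomatch b
          branchMap_injOn := fun b => nomatch b
          abuts_branchMap := fun b => nomatch b }
      hV := fun _ => ⟨φ.toMulEquiv.toMonoidHom, by exact map_continuous φ⟩
      hE := fun e => nomatch e
      comm := fun b => nomatch b }
  refine ⟨F, ⟨Function.bijective_id, ⟨(fun e => nomatch e), (fun e => nomatch e)⟩,
    (fun b => nomatch b), ⟨fun _ => φ.toMulEquiv.bijective, (fun e => nomatch e)⟩⟩, ?_, ?_⟩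
  · intro v ψα ψβ hψα hψβ
    obtain ⟨a, ha⟩ := exists_conj_eq_of_isVerticialHom_affChart v ψα hψα
    obtain ⟨b, hb⟩ := exists_conj_eq_of_isVerticialHom_affChart _ ψβ hψβ
    -- read everything in `Aff(ℤ_q)` (the vertex group and the chart group, definitionally)
    change PadicAffine q →ₜ* PadicAffine q at ψα ψβ
    refine ⟨(φ a * b⁻¹ : PadicAffine q), fun x => ?_⟩
    change PadicAffine q at x
    show φ (ψα x) = φ a * b⁻¹ * ψβ (φ x) * (φ a * b⁻¹)⁻¹
    have h1 : ψα x = a * x * a⁻¹ := (ha x).symm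
    have h2 : ψβ (φ x) = b * φ x * b⁻¹ := (hb (φ x)).symm
    rw [h1, h2, map_mul, map_mul, map_inv]
    group
  · intro F' _ _
    exact ⟨funext fun _ => rfl, funext (fun e => nomatch e)⟩

/-- **F-1727 holds at the origins certifying exactly the one-vertex data** (universe level `0`): if
`Ωα`, `Ωβ` certify only special-fibre data of the form `(affWitness q, affChart q, –)`, then
`SpecialFibreIsoOfChartIso Ωα Ωβ`.  So, unlike (S1)/(S2), the universal closure of (S3) is NOT refuted by
the one-vertex model (it is refuted by no model in the tree at this time); the row stays a schema over the
origin parameter, consumed at a given origin pair by `corollary_3_11_of_steps`.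
[cite: MochizukiSemiAnbd2006, Cor 3.11 pp.46-49] -/
theorem specialFibreIsoOfChartIso_of_affCertifying (q : ℕ) [Fact q.Prime]
    {Kα : Type} [Field Kα] {Kβ : Type} [Field Kβ]
    (Ωα : SpecialFibreOrigin Kα) (Ωβ : SpecialFibreOrigin Kβ)
    (hα : ∀ D S, Ωα.IsSpecialFibreOf D S → S.Gc = affWitness q ∧ HEq S.chart (affChart q))
    (hβ : ∀ D S, Ωβ.IsSpecialFibreOf D S → S.Gc = affWitness q ∧ HEq S.chart (affChart q)) :
    SpecialFibreIsoOfChartIso Ωα Ωβ :=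
  fun Dα Dβ Sα Sβ cα cβ φ =>
    specialFibreIsoOfChartIso_conclusion_affWitness q Sα Sβ (hα Dα Sα cα) (hβ Dβ Sβ cβ) φ

end Literature.AnabelianGeometry.SemiGraphs

end
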